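import Summits.QuantumAdvantage.QuantumAdvantage.Theorems.CubicForrelationNearExactIsExactSixteenThirtyOneThirtySeconds
import Summits.QuantumAdvantage.QuantumAdvantage.Theorems.CubicForrelationNearExactIsExactEighteenSixtyThreeSixtyFourths

/-!
# Crux `CubicForrelation.NearExactIsExact` (stmt-QuantumAdvantage-14043) — UNIFORM certified constants on `8 ≤ n ≤ 18` bits:
  `31/32` isolates exactness for every even `n ∈ [8, 16]`, `63/64` for every even `n ∈ [8, 18]`

Certificate seat `b2b-cforr-cert` (gen 3, 2026-08-19).  HONEST FRAMING: a packaging of finite-slice verdicts as two statements UNIFORM over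
a range of `n` — NOT summit progress (the crux quantifies over all even `n`; the tree's reduction `nearExactIsExact_iff_from_thirty` is
unaffected).  What is new relative to the tree's `isolation_le_sixteen` (`63/64` for even `n ≤ 16`, computational closure through the
`n ≤ 6` checker) is the constant `31/32` up to `n = 16` (`isolation_sixteen_31_32`) and the range `n = 18` at `63/64`
(`isolation_eighteen_63_64`); the statements here start at `n = 8` so that their closure stays free of `native_decide`
(`n ≤ 6` is the certified-compute lemma `nearExact78_le_six`).

* `isolation_31_32_of_le_sixteen`: for every even `n` with `8 ≤ n ≤ 16` and all cubic `f, g` on `n` bits, `Φ(f,g) > 31/32 ⇒ Φ(f,g) = 1`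
  (`n = 8`: `7/8`, `isolation_eight`; `10`: `15/16`, `isolation_ten`; `12`, `14`: `31/32`, `isolation_twelve/fourteen`; `16`: `31/32`,
  `isolation_sixteen_31_32`).
* `isolation_63_64_of_le_eighteen`: the same with `63/64` for every even `8 ≤ n ≤ 18` (`n = 18`: `isolation_eighteen_63_64`).

Axioms: the standard three.
-/

set_option linter.dupNamespace false -- D-0017: single-problem summit ⇒ `QuantumAdvantage.QuantumAdvantage` by design

noncomputable section

namespace Summit.QuantumAdvantage.QuantumAdvantage.Theorems.CubicForrelation.NearExactIsExact

open Finset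
open Literature.Computability.QuantumComplexity

/-- **`31/32` isolates exactness for cubic pairs on every even number `8 ≤ n ≤ 16` of bits**: for such `n` and all cubic
`f, g : 𝔽₂ⁿ → 𝔽₂`, `Φ(f,g) > 31/32 ⇒ Φ(f,g) = 1`.  (The per-`n` constants are `7/8, 15/16, 31/32, 31/32, 31/32`; the last one is
`isolation_sixteen_31_32`.) Finite-slice verdict; NOT summit progress. [this work] -/
theorem isolation_31_32_of_le_sixteen : ∀ n : ℕ, Even n → 8 ≤ n → n ≤ 16 → ∀ f g : (Fin n → Bool) → Bool,
    IsDegLeFun 3 f → IsDegLeFun 3 g → 31 / 32 < forrelation f g → forrelation f g = 1 := by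
  intro n he h8 h16 f g hf hg hlt
  obtain ⟨m, rfl⟩ := he
  have hm : m = 4 ∨ m = 5 ∨ m = 6 ∨ m = 7 ∨ m = 8 := by omega
  rcases hm with rfl | rfl | rfl | rfl | rfl
  · exact isolation_eight f g hf hg (by linarith)
  · exact isolation_ten f g hf hg (by linarith)
  · exact isolation_twelve f g hf hg hlt
  · exact isolation_fourteen f g hf hg hlt
  · exact isolation_sixteen_31_32 f g hf hg hlt

/-- **`63/64` isolates exactness for cubic pairs on every even number `8 ≤ n ≤ 18` of bits**: for such `n` and all cubic
`f, g : 𝔽₂ⁿ → 𝔽₂`, `Φ(f,g) > 63/64 ⇒ Φ(f,g) = 1` (`n ≤ 16`: the previous theorem; `n = 18`: `isolation_eighteen_63_64`).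
Finite-slice verdict; NOT summit progress. [this work] -/
theorem isolation_63_64_of_le_eighteen : ∀ n : ℕ, Even n → 8 ≤ n → n ≤ 18 → ∀ f g : (Fin n → Bool) → Bool,
    IsDegLeFun 3 f → IsDegLeFun 3 g → 63 / 64 < forrelation f g → forrelation f g = 1 := by
  intro n he h8 h18 f g hf hg hlt
  by_cases h16 : n ≤ 16
  · exact isolation_31_32_of_le_sixteen n he h8 h16 f g hf hg (by linarith)
  · obtain ⟨m, rfl⟩ := he
    obtain rfl : m = 9 := by omega
    exact isolation_eighteen_63_64 f g hf hg hlt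

/-- Restricted to even `8 ≤ n ≤ 18`, the crux `NearExactIsExact` HOLDS with the explicit constant `θ = 63/64`; in the crux's own shape
(`∃ θ < 1, …` over that range).  NOT summit progress: the crux needs one `θ` for all even `n`. [this work] -/
theorem nearExact_range_eight_to_eighteen :
    ∃ θ : ℝ, θ < 1 ∧ ∀ n : ℕ, Even n → 8 ≤ n → n ≤ 18 → ∀ f g : (Fin n → Bool) → Bool,
      IsDegLeFun 3 f → IsDegLeFun 3 g → θ < forrelation f g → forrelation f g = 1 :=
  ⟨63 / 64, by norm_num, isolation_63_64_of_le_eighteen⟩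

end Summit.QuantumAdvantage.QuantumAdvantage.Theorems.CubicForrelation.NearExactIsExact

end
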